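import Summits.Ventures.Crystal3D.Theorems.StickyWulffConstantCoaxialWallLawDustDeletion
import Summits.Ventures.Crystal3D.Theorems.StickyWulffConstantCoaxialWallLawOnSiteBridgeJoint
import HarnessLib

/-!
# Deletion of inessential balls: the joint-row corollary and the three tails FROM A RESIDUE HYPOTHESIS
# (crux `CoaxialWallLaw`, stmt-Ventures-19481, line `WallLedgerF`)

HONEST FRAMING. Venture `Summits/Ventures/Crystal3D` (cell `crystal3d-full`), helper `--supports` the crux `CoaxialWallLaw`
(stmt-Ventures-19481, `route-Ventures-StickyWulffConstant`), REGISTERED line `WallLedgerF` (planner cf-p1, DECISION (xci) ORDER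
«land p689691 + joint corollaries»).  Census-free; F-C1 not moved.  The two-line joint twin of
`localSummandA_trans/twin_le_of_deletion_onSite_cx` (`…DustDeletion`) on the joint bridge (`…OnSiteBridgeJoint`):
* **`localSummandA_joint_le_of_deletion_onSite_cx`** — if deleting inessential balls (no deleted ball touches a kept ball within `2`
  of the payer) leaves a window ON-SITE for 𝒰_cx, the translation + joint flat certificates bound the ORIGINAL joint summand;
* **`endRowTransTailA_of_residue`**, **`endRowTwinTailA_of_residue`**, **`endRowJointTailA_of_residue`** — each tail over 𝒰_cx
  follows from the 𝒰_cx flat certificate(s) and the RESIDUE HYPOTHESIS «at every off-module payer window, either some deletion of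
  inessential balls lands on-site for 𝒰_cx, or the summand is `≤ s_F`» — the second disjunct is exactly what the finite fact
  `TailResidueCert` (cf-p1 (xci)) + the type-soundness lemma must deliver for the ESSENTIAL residue.
WHAT THIS IS NOT: not the joint tail; F-C1 not moved.
-/

noncomputable section

namespace Summit.Ventures.Crystal3D.Theorems

open Summit.Ventures.Crystal3D Finset
open scoped InnerProductSpace

/-- **Joint row**: if deleting inessential balls leaves a window ON-SITE for 𝒰_cx, the 𝒰_cx translation and joint flat
certificates bound the ORIGINAL joint summand. -/
theorem localSummandA_joint_le_of_deletion_onSite_cx {X X' : Finset (EuclideanSpace ℝ (Fin 3))} {z : EuclideanSpace ℝ (Fin 3)}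
    {v : WordVersion} {sF : ℝ} (hX : ∀ p ∈ X, ∀ q ∈ X, p ≠ q → 1 ≤ dist p q) (hsub : X' ⊆ X) (hz : z ∈ X')
    (hD : ∀ x ∈ X, x ∉ X' → ∀ y ∈ X', dist z y ≤ 2 → dist x y ≠ 1) (hsite : OnSiteAt coaxialModuleUniverse X' z)
    (honT : EndRowOnSiteFlatA v sF coaxialModuleUniverse) (honJ : EndRowOnSiteJointFlatA v sF coaxialModuleUniverse)
    (L : EuclideanSpace ℝ (Fin 3) ≃ₗᵢ[ℝ] EuclideanSpace ℝ (Fin 3)) :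
    localSummandA v (basalSystem L)
      (basalSystem (((ℝ ∙ EuclideanSpace.single (2 : Fin 3) (1 : ℝ)).reflection).trans L)) X z ≤ sF :=
  (localSummandA_le_of_deletion hX hsub hz hD (fun _ h => (mem_filter.1 h).1) (fun _ h => (mem_filter.1 h).1)).trans
    (localSummandA_joint_le_of_onSite_menu coaxialModule_menu (fun _ hP => mem_coaxialModule_of_mem_universe hP)
      (endRowOnSiteA_cx_of_flat honT) (endRowOnSiteJointA_cx_of_flat honJ) L hsite)

/-- **The joint tail from a tail on reduced windows**: if for every off-module payer window SOME deletion of inessential balls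
lands on-site for 𝒰_cx OR the summand is bounded directly (the essential residue, hypothesis `hres`), the joint tail holds. -/
theorem endRowJointTailA_of_residue {v : WordVersion} {sF : ℝ} (honT : EndRowOnSiteFlatA v sF coaxialModuleUniverse)
    (honJ : EndRowOnSiteJointFlatA v sF coaxialModuleUniverse)
    (hres : ∀ L : EuclideanSpace ℝ (Fin 3) ≃ₗᵢ[ℝ] EuclideanSpace ℝ (Fin 3),
      ∀ X : Finset (EuclideanSpace ℝ (Fin 3)), (∀ p ∈ X, ∀ q ∈ X, p ≠ q → 1 ≤ dist p q) →
      ∀ z ∈ X, (X.filter fun q => dist z q = 1).card ≤ 11 → ¬ OnSiteAt coaxialModuleUniverse X z →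
        (∃ X' ⊆ X, z ∈ X' ∧ (∀ x ∈ X, x ∉ X' → ∀ y ∈ X', dist z y ≤ 2 → dist x y ≠ 1) ∧
          OnSiteAt coaxialModuleUniverse X' z) ∨
        localSummandA v (basalSystem L)
          (basalSystem (((ℝ ∙ EuclideanSpace.single (2 : Fin 3) (1 : ℝ)).reflection).trans L)) X z ≤ sF) :
    EndRowJointTailA v sF coaxialModuleUniverse := by
  intro L X hX z hz hdeg hoff
  rcases hres L X hX z hz hdeg hoff with ⟨X', hsub, hz', hD, hsite⟩ | h
  · exact localSummandA_joint_le_of_deletion_onSite_cx hX hsub hz' hD hsite honT honJ L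
  · exact h

/-- **The translation tail from a residue hypothesis.** -/
theorem endRowTransTailA_of_residue {v : WordVersion} {sF : ℝ} (hon : EndRowOnSiteFlatA v sF coaxialModuleUniverse)
    (hres : ∀ L : EuclideanSpace ℝ (Fin 3) ≃ₗᵢ[ℝ] EuclideanSpace ℝ (Fin 3),
      ∀ X : Finset (EuclideanSpace ℝ (Fin 3)), (∀ p ∈ X, ∀ q ∈ X, p ≠ q → 1 ≤ dist p q) →
      ∀ z ∈ X, (X.filter fun q => dist z q = 1).card ≤ 11 → ¬ OnSiteAt coaxialModuleUniverse X z →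
        (∃ X' ⊆ X, z ∈ X' ∧ (∀ x ∈ X, x ∉ X' → ∀ y ∈ X', dist z y ≤ 2 → dist x y ≠ 1) ∧
          OnSiteAt coaxialModuleUniverse X' z) ∨
        localSummandA v ⟨L, inPlaneRoots L 1⟩ ⟨L, inPlaneRoots L (-1)⟩ X z ≤ sF) :
    EndRowTransTailA v sF coaxialModuleUniverse := by
  intro L X hX z hz hdeg hoff
  rcases hres L X hX z hz hdeg hoff with ⟨X', hsub, hz', hD, hsite⟩ | h
  · exact localSummandA_trans_le_of_deletion_onSite_cx hX hsub hz' hD hsite hon L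
  · exact h

/-- **The twin tail (half-turn form) from a residue hypothesis.** -/
theorem endRowTwinTailA_of_residue {v : WordVersion} {sF : ℝ} (hon : EndRowOnSiteFlatA v sF coaxialModuleUniverse)
    (hres : ∀ L : EuclideanSpace ℝ (Fin 3) ≃ₗᵢ[ℝ] EuclideanSpace ℝ (Fin 3),
      ∀ X : Finset (EuclideanSpace ℝ (Fin 3)), (∀ p ∈ X, ∀ q ∈ X, p ≠ q → 1 ≤ dist p q) →
      ∀ z ∈ X, (X.filter fun q => dist z q = 1).card ≤ 11 → ¬ OnSiteAt coaxialModuleUniverse X z →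
        (∃ X' ⊆ X, z ∈ X' ∧ (∀ x ∈ X, x ∉ X' → ∀ y ∈ X', dist z y ≤ 2 → dist x y ≠ 1) ∧
          OnSiteAt coaxialModuleUniverse X' z) ∨
        localSummandA v ⟨L, inPlaneRoots L 1⟩
          ⟨((ℝ ∙ EuclideanSpace.single (2 : Fin 3) (1 : ℝ)).reflection).trans L,
            inPlaneRoots (((ℝ ∙ EuclideanSpace.single (2 : Fin 3) (1 : ℝ)).reflection).trans L) (-1)⟩ X z ≤ sF) :
    EndRowTwinTailA v sF coaxialModuleUniverse := by
  intro L X hX z hz hdeg hoff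
  rcases hres L X hX z hz hdeg hoff with ⟨X', hsub, hz', hD, hsite⟩ | h
  · exact localSummandA_twin_le_of_deletion_onSite_cx hX hsub hz' hD hsite hon L
  · exact h

end Summit.Ventures.Crystal3D.Theorems


end
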